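import Summits.CriticalPhenomena.PercolationContinuityZ3.Theorems.FK.InfiniteVolumeDefs
import Summits.CriticalPhenomena.PercolationContinuityZ3.Theorems.FK.RandomClusterFiniteEnergy
import Literature.Probability.Percolation.KozmaNitzanTargetLemma
import HarnessLib

/-!
# FRONTIER TRANSPLANT, row FT-03(a), part 3: the finite-energy hypotheses of the measure-generic Steps II–III, DISCHARGED for the
# random-cluster laws of finite pieces of `ℤ^d` lifted to `ℤ^d` (`(rcMeasure G p q B).map (liftEdges Λ)`, every wired set `B`)

Support file (`--supports stmt-CriticalPhenomena-4575`, helper) of the FRONTIER TRANSPLANT sub-cell (`fk-continuity/transplant/`,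
registry row FT-03, seat `prim-bschramm-fkt-p1`); builds on p205010 (kernel theorem, internal audit signed; external expert review
pending).  No definitions, no named facts, no sorries; standard axioms.

HONEST FRAMING (page 1, cell rule).  The transplant's theorem of record `ufsc0_of_freeBoundaryHypothesis_r0 : FH 3 q p → … → ∃ r, UFSC0 3 q p r ε₀`
is CONDITIONAL on the free-boundary penetration hypothesis FH — open at the same `p` for every `q > 1`; by the referee's calibration K1,
[C3a for all `p > p_c(q)`] ∧ C3b gives `p̂_c(q) = p_c(q)`, Grimmett's Conjecture (5.103) / Duminil-Copin–Tassion's Question 5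
(arXiv:1707.07626, p. 9), open for `q ∈ (1,2)`; see the barrier note `SamePFreeBoundaryCriteria` (cell row FBN-01,
`Literature/Barriers/CriticalPhenomena/`, cited statements only) and `FO-19-RECOMMENDATION.md` (NO-GO on criterion 1).  The transplant is a
typed reduction, not a proof of FK continuity.  THIS FILE is unconditional measure transport.

CONTENT.  Parts 1–2 (`KNFreeSeedsEnergy.lean`, `KNFreeSeedsLevels.lean`) port KN Lemma 10 Steps II–III to an arbitrary probability measure `μ`
on `BondConfig (Site d)` under three hypotheses: deletion tolerance `hdel : (1-p)^{|F|} · μ{ω | ω ∖ F ∈ A} ≤ μ(A)`, insertion tolerance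
`hins : π^{|F|} · μ{ω | ω ∪ F ∈ A} ≤ μ(A)` (for `F` inside the pairs of weight `p`), and `hnull` (pairs of weight `0` almost surely closed).
The cell presents finite-volume random-cluster laws on `ℤ^d` as push-forwards along the lift `liftEdges Λ : BondConfig ↥Λ → BondConfig (Site d)`
(`T/FK/InfiniteVolumeDefs.lean`: `rcBoxLaw d b p q n = (rcBoxMeasure d b p q n).map (liftEdges (box d n))`).  Here:

* `liftEdges_sdiff`, `liftEdges_union` — the lift commutes with deleting / inserting a finite set of pairs (it is injective on pairs,
  `Sym2.map.injective Subtype.val_injective`);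
* `tolerance_sdiff_map_liftEdges`, `tolerance_union_map_liftEdges` — **transport**: if a law `ν` on `BondConfig ↥Λ` satisfies deletion
  (resp. insertion) tolerance with constant `c` on the finite sets of pairs inside `E' ⊆ Sym2 ↥Λ`, then `ν.map (liftEdges Λ)` satisfies it,
  in exactly the shape of the hypotheses `hdel` / `hins` of parts 1–2, on the finite sets of pairs inside the lifted `E'`;
* `real_map_liftEdges_not_subset_eq_zero` — under `(rcMeasure G p q B).map (liftEdges Λ)` the open pairs lie almost surely in the lifted
  edge set of `G` (the shape of `hnull`: `real_map_liftEdges_compl_posOnly_eq_zero` for every weighting `W` positive on the lifted edges);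
* **`del_tolerance_rcMeasure_map_liftEdges`, `ins_tolerance_rcMeasure_map_liftEdges`** — for every finite piece `Λ ⊆ ℤ^d`, every graph `G`
  on `↥Λ`, every `0 ≤ p ≤ 1`, `q ≥ 1` and EVERY wired set `B ⊆ ↥Λ`: the lifted law `(rcMeasure G p q B).map (liftEdges Λ)` satisfies `hdel`
  with constant `1 - p` (all finite `F`) and `hins` with constant `p/(p + q(1-p))` (finite `F` inside the lifted edge set of `G`) — Grimmett's
  two-sided finite energy (Thm. (3.1) eq. (3.4)) in the integrated form of the cell's `FK.rcMeasure_pow_mul_real_preimage_sdiff_le` /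
  `FK.rcMeasure_pow_mul_real_preimage_openEdges_le` (`T/FK/RandomClusterFiniteEnergy.lean`), transported.
So for the free / wired / arbitrarily-wired random-cluster law of any finite subgraph of `ℤ^d` (in particular a fresh corridor with the
revealed-open clusters wired, the law `P^x = P_{R_x,h}` of refuter F4 once typed that way) the hypotheses of `KNFree.stepII` /
`KNFree.real_manyContacts_diff_Gev_le` / `KNFree.exists_level_real_Gev_gt` hold with `π = p/(p + q(1-p))`; laws presented with edge WEIGHTS
(`rcMeasureW (condWeights …) q B`) need the weights form of the two tolerance lemmas (registry row FO-10b) and then the same transport.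
[cite: Grimmett2006, Thm. (3.1) eq. (3.4) (p. 38); Thm. (4.17)(b) (p. 75); §4.2 (4.11)–(4.12)] [cite: KozmaNitzan2024, §4 Lemma 10, Steps II–III (pp. 18–19)]
-/

noncomputable section

namespace Summit.CriticalPhenomena.PercolationContinuityZ3.Theorems.FK.KNFree

open MeasureTheory Set
open Literature.Probability.Percolation Literature.Probability.LatticeModels
open Literature.Probability.Percolation.KozmaNitzan
open scoped Classical

variable {d : ℕ}

/-! ## The lift of pairs and its set algebra -/

/-- The lift of pairs `Sym2 ↥Λ → Sym2 (Site d)` is injective. [folklore] -/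
theorem sym2Map_val_injective (Λ : Finset (Site d)) :
    Function.Injective (Sym2.map (Subtype.val : ↥Λ → Site d)) :=
  Sym2.map.injective Subtype.val_injective

/-- The lift commutes with deleting a finite set of pairs. [folklore] -/
theorem liftEdges_sdiff (Λ : Finset (Site d)) (ω' : BondConfig ↥Λ) (F' : Finset (Sym2 ↥Λ)) :
    liftEdges Λ (ω' \ ↑F') = liftEdges Λ ω' \ ↑(F'.image (Sym2.map Subtype.val)) := by
  unfold liftEdges
  rw [Finset.coe_image, Set.image_sdiff (sym2Map_val_injective Λ)]

/-- The lift commutes with inserting a finite set of pairs. [folklore] -/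
theorem liftEdges_union (Λ : Finset (Site d)) (ω' : BondConfig ↥Λ) (F' : Finset (Sym2 ↥Λ)) :
    liftEdges Λ (ω' ∪ ↑F') = liftEdges Λ ω' ∪ ↑(F'.image (Sym2.map Subtype.val)) := by
  unfold liftEdges
  rw [Finset.coe_image, Set.image_union]

/-- A lifted configuration consists of lifted pairs. [folklore] -/
theorem liftEdges_subset_range (Λ : Finset (Site d)) (ω' : BondConfig ↥Λ) :
    liftEdges Λ ω' ⊆ Set.range (Sym2.map (Subtype.val : ↥Λ → Site d)) :=
  Set.image_subset_range _ _

/-- A finite set of pairs inside a lifted finite set is the lift of its pull-back, of the same size. [folklore] -/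
theorem exists_image_eq_of_subset_image (Λ : Finset (Site d)) {E' : Finset (Sym2 ↥Λ)} {F : Finset (Sym2 (Site d))}
    (hF : F ⊆ E'.image (Sym2.map Subtype.val)) :
    ∃ F' : Finset (Sym2 ↥Λ), F' ⊆ E' ∧ F'.image (Sym2.map Subtype.val) = F ∧ F'.card = F.card := by
  refine ⟨E'.filter fun e' => Sym2.map Subtype.val e' ∈ F, Finset.filter_subset _ _, ?_, ?_⟩
  · ext e
    simp only [Finset.mem_image, Finset.mem_filter]
    constructor
    · rintro ⟨e', ⟨-, he'F⟩, rfl⟩; exact he'F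
    · intro he
      obtain ⟨e', he'E, rfl⟩ := Finset.mem_image.1 (hF he)
      exact ⟨e', ⟨he'E, he⟩, rfl⟩
  · have h := Finset.card_image_of_injective (E'.filter fun e' => Sym2.map Subtype.val e' ∈ F) (sym2Map_val_injective Λ)
    rw [← h]
    congr 1
    ext e
    simp only [Finset.mem_image, Finset.mem_filter]
    constructor
    · rintro ⟨e', ⟨-, he'F⟩, rfl⟩; exact he'F
    · intro he
      obtain ⟨e', he'E, rfl⟩ := Finset.mem_image.1 (hF he)
      exact ⟨e', ⟨he'E, he⟩, rfl⟩

/-! ## Transport of tolerance along the lift -/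

/-- Inserting a fixed set of pairs is a measurable map of configurations. [folklore] -/
theorem measurable_union_const {V : Type*} (F : Set (Sym2 V)) : Measurable fun ω : BondConfig V => ω ∪ F :=
  measurable_set_iff.2 fun e => (measurable_set_mem e).or measurable_const

/-- The push-forward along the lift, evaluated on a measurable event. [folklore] -/
theorem real_map_liftEdges_apply (Λ : Finset (Site d)) (ν : Measure (BondConfig ↥Λ)) {s : Set (BondConfig (Site d))}
    (hs : MeasurableSet s) : (ν.map (liftEdges Λ)).real s = ν.real (liftEdges Λ ⁻¹' s) := by
  rw [measureReal_def, Measure.map_apply (measurable_of_finite (liftEdges Λ)) hs, measureReal_def]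

/-- **Transport of deletion tolerance along the lift**: if `c^{|F'|} · ν{ω' | ω' ∖ F' ∈ A'} ≤ ν(A')` for all finite `F' ⊆ E'` and all
events `A'` of the finite piece, then the lifted law satisfies `c^{|F|} · μ{ω | ω ∖ F ∈ A} ≤ μ(A)` for all finite `F` inside the lifted `E'`
and all measurable `A` — the hypothesis `hdel` of `KNFree.stepII`. [cite: Grimmett2006, Thm. (3.1) eq. (3.4) (p. 38)] -/
theorem tolerance_sdiff_map_liftEdges (Λ : Finset (Site d)) (ν : Measure (BondConfig ↥Λ)) {c : ℝ} (E' : Finset (Sym2 ↥Λ))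
    (hν : ∀ (F' : Finset (Sym2 ↥Λ)) (A' : Set (BondConfig ↥Λ)), F' ⊆ E' →
      c ^ F'.card * ν.real ((fun ω' => ω' \ ↑F') ⁻¹' A') ≤ ν.real A')
    {F : Finset (Sym2 (Site d))} (hF : F ⊆ E'.image (Sym2.map Subtype.val)) {A : Set (BondConfig (Site d))}
    (hA : MeasurableSet A) :
    c ^ F.card * (ν.map (liftEdges Λ)).real ((fun ω => ω \ ↑F) ⁻¹' A) ≤ (ν.map (liftEdges Λ)).real A := by
  obtain ⟨F', hF'E, hF'img, hcard⟩ := exists_image_eq_of_subset_image Λ hF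
  -- `ω ↦ ω ∖ F` is measurable (the tree's `BoundaryTwoArmDecay.StubReduction.measurable_sdiff_const`, inlined to keep the imports local)
  have hmeas : Measurable fun ω : BondConfig (Site d) => ω \ (↑F : Set (Sym2 (Site d))) :=
    measurable_set_iff.2 fun e => (measurable_set_mem e).and measurable_const
  rw [real_map_liftEdges_apply Λ ν (hmeas hA), real_map_liftEdges_apply Λ ν hA]
  have hpre : liftEdges Λ ⁻¹' ((fun ω => ω \ ↑F) ⁻¹' A) = (fun ω' => ω' \ ↑F') ⁻¹' (liftEdges Λ ⁻¹' A) := by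
    ext ω'
    simp only [mem_preimage]
    rw [liftEdges_sdiff, hF'img]
  rw [hpre, ← hcard]
  exact hν F' _ hF'E

/-- **Transport of insertion tolerance along the lift** (the hypothesis `hins` of `KNFree.real_manyContacts_diff_Gev_le`).
[cite: Grimmett2006, Thm. (3.1) eq. (3.4) (p. 38)] -/
theorem tolerance_union_map_liftEdges (Λ : Finset (Site d)) (ν : Measure (BondConfig ↥Λ)) {c : ℝ} (E' : Finset (Sym2 ↥Λ))
    (hν : ∀ (F' : Finset (Sym2 ↥Λ)) (A' : Set (BondConfig ↥Λ)), F' ⊆ E' →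
      c ^ F'.card * ν.real ((fun ω' => ω' ∪ ↑F') ⁻¹' A') ≤ ν.real A')
    {F : Finset (Sym2 (Site d))} (hF : F ⊆ E'.image (Sym2.map Subtype.val)) {A : Set (BondConfig (Site d))}
    (hA : MeasurableSet A) :
    c ^ F.card * (ν.map (liftEdges Λ)).real ((fun ω => ω ∪ ↑F) ⁻¹' A) ≤ (ν.map (liftEdges Λ)).real A := by
  obtain ⟨F', hF'E, hF'img, hcard⟩ := exists_image_eq_of_subset_image Λ hF
  rw [real_map_liftEdges_apply Λ ν ((measurable_union_const _) hA), real_map_liftEdges_apply Λ ν hA]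
  have hpre : liftEdges Λ ⁻¹' ((fun ω => ω ∪ ↑F) ⁻¹' A) = (fun ω' => ω' ∪ ↑F') ⁻¹' (liftEdges Λ ⁻¹' A) := by
    ext ω'
    simp only [mem_preimage]
    rw [liftEdges_union, hF'img]
  rw [hpre, ← hcard]
  exact hν F' _ hF'E

/-! ## The random-cluster law of a finite piece of `ℤ^d`, lifted: all three hypotheses discharged -/

section RandomCluster

variable (Λ : Finset (Site d)) (G : SimpleGraph ↥Λ) [DecidableRel G.Adj]

/-- **Deletion tolerance of the lifted random-cluster law** `(φ^B_{G,p,q}).map (liftEdges Λ)`, every wired set `B`, every finite set of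
pairs: the hypothesis `hdel` of `KNFree.stepII` with constant `1 - p`. [cite: Grimmett2006, Thm. (3.1) eq. (3.4) (p. 38); Thm. (4.17)(b) (p. 75)] -/
theorem del_tolerance_rcMeasure_map_liftEdges {p q : ℝ} (hp : p ∈ Set.Icc (0 : ℝ) 1) (hq : 1 ≤ q) (B : Set ↥Λ)
    {F : Finset (Sym2 (Site d))} (hF : F ⊆ (Finset.univ : Finset (Sym2 ↥Λ)).image (Sym2.map Subtype.val))
    {A : Set (BondConfig (Site d))} (hA : MeasurableSet A) :
    (1 - p) ^ F.card * ((rcMeasure G p q B).map (liftEdges Λ)).real ((fun ω => ω \ ↑F) ⁻¹' A) ≤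
      ((rcMeasure G p q B).map (liftEdges Λ)).real A :=
  tolerance_sdiff_map_liftEdges Λ (rcMeasure G p q B) Finset.univ
    (fun F' A' _ => rcMeasure_pow_mul_real_preimage_sdiff_le G hp hq B F' A') hF hA

/-- **Insertion tolerance of the lifted random-cluster law** `(φ^B_{G,p,q}).map (liftEdges Λ)`, every wired set `B`, finite sets of pairs
inside the lifted edge set of `G`: the hypothesis `hins` of `KNFree.real_manyContacts_diff_Gev_le` with `π = p/(p + q(1-p))`.
[cite: Grimmett2006, Thm. (3.1) eq. (3.4) (p. 38); Thm. (4.17)(b) (p. 75)] -/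
theorem ins_tolerance_rcMeasure_map_liftEdges {p q : ℝ} (hp : p ∈ Set.Icc (0 : ℝ) 1) (hq : 1 ≤ q) (B : Set ↥Λ)
    {F : Finset (Sym2 (Site d))} (hF : F ⊆ G.edgeFinset.image (Sym2.map Subtype.val))
    {A : Set (BondConfig (Site d))} (hA : MeasurableSet A) :
    (p / (p + q * (1 - p))) ^ F.card * ((rcMeasure G p q B).map (liftEdges Λ)).real ((fun ω => ω ∪ ↑F) ⁻¹' A) ≤
      ((rcMeasure G p q B).map (liftEdges Λ)).real A :=
  tolerance_union_map_liftEdges Λ (rcMeasure G p q B) G.edgeFinset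
    (fun _ A' hF' => rcMeasure_pow_mul_real_preimage_openEdges_le G hp hq B hF' A') hF hA

/-- The random-cluster measure of a finite graph charges only subsets of its edge set. [cite: Grimmett2006, §1.2 eq. (1.2)] -/
theorem rcMeasure_real_not_subset_edgeSet_eq_zero {p q : ℝ} (hp : p ∈ Set.Icc (0 : ℝ) 1) (hq : 0 < q) (B : Set ↥Λ) :
    (rcMeasure G p q B).real {ω' : BondConfig ↥Λ | ¬ ω' ⊆ G.edgeSet} = 0 := by
  rw [rcMeasure_real_apply G hp hq B]
  refine Finset.sum_eq_zero fun ω' hω' => ?_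
  rw [Finset.mem_powerset] at hω'
  have hsub : (↑ω' : BondConfig ↥Λ) ⊆ G.edgeSet := fun e he => by
    have := hω' (Finset.mem_coe.1 he)
    rwa [SimpleGraph.mem_edgeFinset] at this
  rw [if_neg (fun h => h hsub)]

/-- **Under the lifted random-cluster law the open pairs lie almost surely in the lifted edge set of `G`.**
[cite: Grimmett2006, §1.2 eq. (1.2); §4.2 (configurations on E_Λ)] -/
theorem real_map_liftEdges_not_subset_eq_zero {p q : ℝ} (hp : p ∈ Set.Icc (0 : ℝ) 1) (hq : 0 < q) (B : Set ↥Λ) :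
    ((rcMeasure G p q B).map (liftEdges Λ)).real
        {ω : BondConfig (Site d) | ¬ ω ⊆ Sym2.map Subtype.val '' G.edgeSet} = 0 := by
  have hmeas : MeasurableSet {ω : BondConfig (Site d) | ¬ ω ⊆ Sym2.map Subtype.val '' G.edgeSet} := by
    have h : {ω : BondConfig (Site d) | ¬ ω ⊆ Sym2.map Subtype.val '' G.edgeSet} =
        ⋃ e ∈ (Sym2.map Subtype.val '' G.edgeSet)ᶜ, {ω | e ∈ ω} := by
      ext ω
      simp only [mem_setOf_eq, Set.not_subset, mem_iUnion, mem_compl_iff, exists_prop]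
      exact ⟨fun ⟨e, he, hne⟩ => ⟨e, hne, he⟩, fun ⟨e, hne, he⟩ => ⟨e, he, hne⟩⟩
    rw [h]
    exact MeasurableSet.biUnion (Set.to_countable _) fun e _ => measurableSet_mem e
  haveI := isProbabilityMeasure_rcMeasure G hp hq B
  rw [real_map_liftEdges_apply Λ _ hmeas]
  refine le_antisymm ?_ measureReal_nonneg
  calc (rcMeasure G p q B).real (liftEdges Λ ⁻¹' {ω | ¬ ω ⊆ Sym2.map Subtype.val '' G.edgeSet})
      ≤ (rcMeasure G p q B).real {ω' : BondConfig ↥Λ | ¬ ω' ⊆ G.edgeSet} := by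
        refine measureReal_mono (fun ω' hω' hsub => hω' ?_) (measure_ne_top _ _)
        exact Set.image_mono hsub
    _ = 0 := rcMeasure_real_not_subset_edgeSet_eq_zero Λ G hp hq B

/-- **The hypothesis `hnull` for the lifted random-cluster law**: for every weighting `W` of the pairs of `ℤ^d` that is nonzero on the
lifted edges of `G`, almost surely every open pair has nonzero weight (`μ((PosOnly W)ᶜ) = 0`). [cite: Grimmett2006, §4.2 (configurations on E_Λ)] -/
theorem real_map_liftEdges_compl_posOnly_eq_zero {p q : ℝ} (hp : p ∈ Set.Icc (0 : ℝ) 1) (hq : 0 < q) (B : Set ↥Λ)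
    (W : Sym2 (Site d) → unitInterval) (hW : ∀ e' ∈ G.edgeSet, W (Sym2.map Subtype.val e') ≠ 0) :
    ((rcMeasure G p q B).map (liftEdges Λ)).real (LData.PosOnly W)ᶜ = 0 := by
  haveI := isProbabilityMeasure_rcMeasure G hp hq B
  haveI : IsProbabilityMeasure ((rcMeasure G p q B).map (liftEdges Λ)) :=
    Measure.isProbabilityMeasure_map (measurable_of_finite (liftEdges Λ)).aemeasurable
  refine le_antisymm ?_ measureReal_nonneg
  calc ((rcMeasure G p q B).map (liftEdges Λ)).real (LData.PosOnly W)ᶜ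
      ≤ ((rcMeasure G p q B).map (liftEdges Λ)).real {ω : BondConfig (Site d) | ¬ ω ⊆ Sym2.map Subtype.val '' G.edgeSet} := by
        refine measureReal_mono (fun ω hω hsub => hω ?_) (measure_ne_top _ _)
        intro e he
        obtain ⟨e', he', rfl⟩ := hsub he
        exact hW e' he'
    _ = 0 := real_map_liftEdges_not_subset_eq_zero Λ G hp hq B

end RandomCluster

end Summit.CriticalPhenomena.PercolationContinuityZ3.Theorems.FK.KNFree

end
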